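/-
Copyright (c) 2026 the pub-hodgecm-mathlib formalisation cell (harness21).  Prover seat hodgecm-mathlib-K2E4-p23 (g2), Track B ∕ K2-LIT, h413 =
`stmt-HodgeConjecture-24833`, ENGINE E1, 5Res campaign «ENDGAME BY FAMILIES», ROADCARD §3′ (M2 v2) with amendment #2 (228), deal (234) of K2E1-plan (g7): D5′ PROPER,
hypothesis-first, abstract `G ∕ π` layer — «an irreducible summand has no continuous spectrum at any K-type».
-/
import Summits.HodgeConjecture.HodgeConjecture.Theorems.K2E1HeckeModuleIrreducibleSchurU              -- ★ (this seat) (S1)+(S3): `exists_apply_eq_smul_of_commute_compression`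
import Summits.HodgeConjecture.HodgeConjecture.Theorems.K2E1ZeroOneLawSpectralSupport                -- ★ (this seat) D5′-abs: `indicator_lpSMul_eq_zero_iff` (+ ★ D1′ currency `memLp_top_indicator`)
import Summits.HodgeConjecture.HodgeConjecture.Theorems.K2E1ProjectionCommutingMultiplicationOperators -- ★ (K2E4-p11): `ae_eq_zero_of_ae_smul_eq_smul_of_joint_null`
import HarnessLib

/-!
# K2·E1 — `K2E1IrreducibleNoContinuousSpectrumU`: AN IRREDUCIBLE SUMMAND HAS NO CONTINUOUS SPECTRUM AT ANY K-TYPE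
# (ROADCARD §3′.1 step (ii′)–(iii′), D5′ PROPER — abstract layer: every E1 letter plugs by name)

Track B ∕ K2-LIT, crux h413 = `stmt-HodgeConjecture-24833`, route of record `HCCMUnconditional`; cell `hodgecm-mathlib`, squad K2, ENGINE E1 (5Res campaign, M2 v2).  Prover seat
`hodgecm-mathlib-K2E4-p23` (g2); deal (234).  THEOREMS ONLY (no `def`, no `instance`, no notation, no named-fact hypothesis, no `sorry`); lane
`--supports stmt-HodgeConjecture-24833 --as helper` (count-neutral).  Abstract — no automorphic object.  CLOSES NO SOCKET.

THE ARGUMENT (§3′.1 (ii′)(iii′) after amendment #2).  On the `(τ,K′)`-block `V = range P` of an irreducible `π`, each arch-central Hecke operator `T_j` acts by a scalar `c_j` (★ (S3),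
compression edition); through the model map `U` (E1: the Plancherel isometry of the family, composed with `P`), `T_j` becomes multiplication by its symbol `s_j`, so `s_j · U v = c_j · U v`
a.e., i.e. `U v` lives on the joint level set `⋂_j {s_j = c_j}`; the LINE LETTER (hline) «every joint level set meets the line part `Λ` in an `m`-null set» (E1 payer: `s_j` holomorphic
non-constant on each line ⇒ countable level sets; ★ D3 + ★ p860148) kills the line part: **`𝟙_Λ • U v = 0`**.
* §1 ANALYTIC CORE (no `π`): **`indicator_lpSMul_eq_zero_of_eigen`** — from `hscalar : T_j = c_j` on `V`, the intertwining `hU : U (T_j v) = s_j • U v` and (hline).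
* §2 IRREDUCIBLE `π` ON `H`: **`indicator_lpSMul_eq_zero_of_irreducible`** — `hscalar` discharged by ★ `exists_apply_eq_smul_of_commute_compression` from (A1)(A2)(A3), the projector
  letters and «`T_j|_V` commutes with the compressions `P A|_V`» (the (S2) shape).
* §3 IRREDUCIBLE CLOSED `W ≤ H` (`π` arbitrary, E1: `R` on `L²` or on `(L²_cusp)ᗮ`): restriction lemmas (`𝓐|_W` keeps (A1)(A2)(A3) when `𝓐` preserves `W`; `P|_W`, `V ⊓ W`, `T|_W` keep
  their letters) ⇒ **`indicator_lpSMul_proj_eq_zero_of_irreducible_subrep`**: `𝟙_Λ • U (P w) = 0` for every `w` of every irreducible closed `W` preserved by `𝓐`, `P`, `T_j` — the (234)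
  conclusion verbatim.
HONEST LABEL: HC_CM is proved only modulo the 7 printed citations (2 remaining named inputs: hLiu418 = `stmt-HodgeConjecture-24832`, h413 = `stmt-HodgeConjecture-24833`) until rung 0
closes; this file asserts no named fact and closes no socket; count-neutral.

## References
* [MoeglinWaldspurger1995] C. Mœglin, J.-L. Waldspurger, *Spectral decomposition and Eisenstein series* (1995), IV.3.12 (b), VI.2.
* [DeitmarEchterhoff2014] A. Deitmar, S. Echterhoff, *Principles of Harmonic Analysis* (2014), Lemma 6.1.7.
* [ReedSimonI1980] M. Reed, B. Simon, *Methods of Modern Mathematical Physics I* (1980), §VII.2.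
-/

set_option autoImplicit false
-- the mandated namespace repeats the single-problem summit's segment (`HodgeConjecture.HodgeConjecture`)
set_option linter.dupNamespace false

noncomputable section

open ContRepresentation MeasureTheory Set Filter
open scoped InnerProductSpace ENNReal
open Summit.HodgeConjecture.HodgeConjecture.Cruxes.H413.K2E1HeckeModuleIrreducibleSchurU (exists_apply_eq_smul_of_commute_compression)
open Summit.HodgeConjecture.HodgeConjecture.Cruxes.H413.K2E1ZeroOneLawSpectralSupport (indicator_lpSMul_eq_zero_iff)
open Summit.HodgeConjecture.HodgeConjecture.Cruxes.H413.K2E1ProjectionCommutingMultiplicationOperators (ae_eq_zero_of_ae_smul_eq_smul_of_joint_null)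

namespace Summit.HodgeConjecture.HodgeConjecture.Cruxes.H413.K2E1IrreducibleNoContinuousSpectrumU

variable {H : Type*} [NormedAddCommGroup H] [InnerProductSpace ℂ H]
  {Ω : Type*} {mΩ : MeasurableSpace Ω} {m : Measure Ω} {E : Type*} [NormedAddCommGroup E] [NormedSpace ℂ E]
  {J : Type*} [Countable J]
variable [ENNReal.HolderTriple ∞ 2 2]

/-! ## §1 The analytic core: joint eigenvectors have no mass on the line part -/

/-- **ANALYTIC CORE.**  `V ≤ H`, a linear model map `U : H → L²(Ω; E)`, operators `T_j` acting on `V` by scalars (`hscalar`) and carried by `U` to multiplication by bounded symbols `s_j`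
(`hU`); if every joint level set `{∀ j, s_j = c_j}` meets the measurable line part `Λ` in an `m`-null set (hline), then `𝟙_Λ • U v = 0` for every `v ∈ V`.
[cite: ReedSimonI1980, §VII.2] [cite: MoeglinWaldspurger1995, IV.3.12] -/
theorem indicator_lpSMul_eq_zero_of_eigen (V : Submodule ℂ H) (U : H →ₗ[ℂ] Lp E 2 m) (T : J → H →L[ℂ] H) (s : J → Ω → ℂ) (hs : ∀ j, MemLp (s j) ∞ m)
    (hU : ∀ j, ∀ v ∈ V, U (T j v) = (hs j).toLp (s j) • U v) (hscalar : ∀ j, ∃ c : ℂ, ∀ v ∈ V, T j v = c • v)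
    {Λ : Set Ω} (hΛ : MeasurableSet Λ) (hline : ∀ c : J → ℂ, m (Λ ∩ {x | ∀ j, s j x = c j}) = 0) (hΛ1 : MemLp (Λ.indicator fun _ : Ω => (1 : ℂ)) ∞ m)
    {v : H} (hv : v ∈ V) :
    (hΛ1.toLp (Λ.indicator fun _ : Ω => (1 : ℂ)) • U v : Lp E 2 m) = 0 := by
  choose c hc using hscalar
  rw [indicator_lpSMul_eq_zero_iff (U v) hΛ hΛ1]
  -- a.e. `s_j · f = c_j · f` for `f = U v`
  have hae : ∀ j, ∀ᵐ x ∂(m.restrict Λ), s j x • (U v : Ω → E) x = c j • (U v : Ω → E) x := fun j => by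
    refine ae_restrict_of_ae ?_
    have h1 : ((hs j).toLp (s j) • U v : Lp E 2 m) = c j • U v := by rw [← hU j v hv, hc j v hv, map_smul]
    have h2 : (((hs j).toLp (s j) • U v : Lp E 2 m) : Ω → E) =ᵐ[m] ((c j • U v : Lp E 2 m) : Ω → E) := by rw [h1]
    filter_upwards [h2, Lp.coeFn_lpSMul (r := 2) ((hs j).toLp (s j)) (U v), (hs j).coeFn_toLp, Lp.coeFn_smul (c j) (U v)] with x hx hx1 hx2 hx3
    rw [← hx2, ← Pi.smul_apply' , ← hx1, hx, hx3, Pi.smul_apply]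
  refine ae_eq_zero_of_ae_smul_eq_smul_of_joint_null hae ?_
  rw [Measure.restrict_apply' hΛ, Set.inter_comm]
  exact hline c

/-! ## §2 Irreducible `π` on `H`: the scalars come from (S3) -/

/-- **NO CONTINUOUS SPECTRUM FOR AN IRREDUCIBLE `π` (on its own space).**  `π` topologically irreducible on the Hilbert space `H`; `𝓐` with (A1)(A2)(A3); `P` a symmetric projection onto
the closed block `V`; operators `T_j` preserving `V` whose compressions commute with the `P A|_V` (the (S2) shape) and which the linear model map `U` carries to multiplications by `s_j`;
line letter (hline).  THEN `𝟙_Λ • U v = 0` for every `v ∈ V`. [cite: MoeglinWaldspurger1995, IV.3.12, VI.2] [cite: DeitmarEchterhoff2014, Lemma 6.1.7] -/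
theorem indicator_lpSMul_eq_zero_of_irreducible [CompleteSpace H] {G : Type*} [Group G] {π : ContRepresentation ℂ G H} (hirr : π.IsTopIrreducible)
    {𝓐 : Set (H →L[ℂ] H)} (h𝓐 : ∀ (g : G), ∀ A ∈ 𝓐, (π g).comp A ∈ 𝓐) (hnd : ∀ v : H, (∀ A ∈ 𝓐, A v = 0) → v = 0)
    (hstar : ∀ A ∈ 𝓐, ContinuousLinearMap.adjoint A ∈ 𝓐)
    (V : Submodule ℂ H) (hVc : IsClosed (V : Set H)) (P : H →L[ℂ] H) (hPV : ∀ x, P x ∈ V) (hPid : ∀ v ∈ V, P v = v) (hPsa : ∀ x y : H, ⟪P x, y⟫_ℂ = ⟪x, P y⟫_ℂ)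
    (T : J → H →L[ℂ] H) (hTV : ∀ j, ∀ x ∈ V, T j x ∈ V) (hTB : ∀ j, ∀ A ∈ 𝓐, ∀ x ∈ V, P (A (T j x)) = T j (P (A x)))
    (U : H →ₗ[ℂ] Lp E 2 m) (s : J → Ω → ℂ) (hs : ∀ j, MemLp (s j) ∞ m) (hU : ∀ j, ∀ v ∈ V, U (T j v) = (hs j).toLp (s j) • U v)
    {Λ : Set Ω} (hΛ : MeasurableSet Λ) (hline : ∀ c : J → ℂ, m (Λ ∩ {x | ∀ j, s j x = c j}) = 0) (hΛ1 : MemLp (Λ.indicator fun _ : Ω => (1 : ℂ)) ∞ m)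
    {v : H} (hv : v ∈ V) :
    (hΛ1.toLp (Λ.indicator fun _ : Ω => (1 : ℂ)) • U v : Lp E 2 m) = 0 :=
  indicator_lpSMul_eq_zero_of_eigen V U T s hs hU
    (fun j => exists_apply_eq_smul_of_commute_compression hirr h𝓐 hnd hstar V hVc P hPV hPid hPsa (T j) (hTV j) (hTB j)) hΛ hline hΛ1 hv

/-! ## §3 Irreducible closed subrepresentations `W ≤ H` of an arbitrary `π`: restriction -/

section Restrict

variable [CompleteSpace H] {G : Type*} [Group G] {π : ContRepresentation ℂ G H}

omit [ENNReal.HolderTriple ∞ 2 2] [CompleteSpace H] in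
/-- (A1) restricts: `π|_W g ∘ A|_W = (π g ∘ A)|_W`. [folklore] -/
theorem restrict_A1 (W : ClosedSubrep π) {𝓐 : Set (H →L[ℂ] H)} (h𝓐 : ∀ (g : G), ∀ A ∈ 𝓐, (π g).comp A ∈ 𝓐) (hAW : ∀ A ∈ 𝓐, ∀ w ∈ W, A w ∈ W) (g : G) :
    ∀ B ∈ {B : W.toSubmodule →L[ℂ] W.toSubmodule | ∃ A, ∃ hA : A ∈ 𝓐, B = (A.comp W.toSubmodule.subtypeL).codRestrict W.toSubmodule fun w => hAW A hA (w : H) w.2},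
      (W.toContRep g).comp B ∈ {B : W.toSubmodule →L[ℂ] W.toSubmodule | ∃ A, ∃ hA : A ∈ 𝓐, B = (A.comp W.toSubmodule.subtypeL).codRestrict W.toSubmodule fun w => hAW A hA (w : H) w.2} := by
  rintro _ ⟨A, hA, rfl⟩
  refine ⟨(π g).comp A, h𝓐 g A hA, ?_⟩
  apply ContinuousLinearMap.ext
  intro w
  apply Subtype.ext
  rfl

omit [ENNReal.HolderTriple ∞ 2 2] [CompleteSpace H] in
/-- (A2) restricts. [folklore] -/
theorem restrict_A2 (W : ClosedSubrep π) {𝓐 : Set (H →L[ℂ] H)} (hnd : ∀ v : H, (∀ A ∈ 𝓐, A v = 0) → v = 0) (hAW : ∀ A ∈ 𝓐, ∀ w ∈ W, A w ∈ W)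
    (w : W.toSubmodule)
    (hw : ∀ B ∈ {B : W.toSubmodule →L[ℂ] W.toSubmodule | ∃ A, ∃ hA : A ∈ 𝓐, B = (A.comp W.toSubmodule.subtypeL).codRestrict W.toSubmodule fun w => hAW A hA (w : H) w.2}, B w = 0) :
    w = 0 := by
  apply Subtype.ext
  refine hnd (w : H) fun A hA => ?_
  have h := hw _ ⟨A, hA, rfl⟩
  rw [Subtype.ext_iff, ContinuousLinearMap.coe_codRestrict_apply] at h
  exact h

omit [ENNReal.HolderTriple ∞ 2 2] in
/-- (A3) restricts: the adjoint of `A|_W` is `A†|_W` when `𝓐` (closed under adjoints) preserves `W`. [folklore] -/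
theorem restrict_A3 (W : ClosedSubrep π) {𝓐 : Set (H →L[ℂ] H)} (hstar : ∀ A ∈ 𝓐, ContinuousLinearMap.adjoint A ∈ 𝓐) (hAW : ∀ A ∈ 𝓐, ∀ w ∈ W, A w ∈ W) :
    ∀ B ∈ {B : W.toSubmodule →L[ℂ] W.toSubmodule | ∃ A, ∃ hA : A ∈ 𝓐, B = (A.comp W.toSubmodule.subtypeL).codRestrict W.toSubmodule fun w => hAW A hA (w : H) w.2},
      ContinuousLinearMap.adjoint B ∈ {B : W.toSubmodule →L[ℂ] W.toSubmodule | ∃ A, ∃ hA : A ∈ 𝓐, B = (A.comp W.toSubmodule.subtypeL).codRestrict W.toSubmodule fun w => hAW A hA (w : H) w.2} := by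
  rintro _ ⟨A, hA, rfl⟩
  refine ⟨ContinuousLinearMap.adjoint A, hstar A hA, ?_⟩
  symm
  rw [ContinuousLinearMap.eq_adjoint_iff]
  intro x y
  rw [Submodule.coe_inner, Submodule.coe_inner, ContinuousLinearMap.coe_codRestrict_apply, ContinuousLinearMap.coe_codRestrict_apply]
  exact ContinuousLinearMap.adjoint_inner_left A (y : H) (x : H)

/-- **NO CONTINUOUS SPECTRUM FOR AN IRREDUCIBLE CLOSED SUBREPRESENTATION `W` OF AN ARBITRARY `π`** (the (234) conclusion): `π` on `H` (E1: `R` on `L²` or on `(L²_cusp)ᗮ`), `𝓐` with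
(A1)(A2)(A3) preserving `W` (`hAW`; E1: every `R(f)` preserves closed invariant subspaces), the block projector `P` (`hPV hPid hPsa`, preserving `W`: `hPW`), operators `T_j` (preserving
`V` and `W`, compressions commuting: `hTV hTW hTB`), the linear model map `U` with symbols `s_j` (`hU` on `V`), the line letter (hline); THEN for every topologically irreducible closed
`W` and every `w ∈ W`: **`𝟙_Λ • U (P w) = 0`**. [cite: MoeglinWaldspurger1995, IV.3.12, VI.2] [cite: DeitmarEchterhoff2014, Lemma 6.1.7] -/
theorem indicator_lpSMul_proj_eq_zero_of_irreducible_subrep (W : ClosedSubrep π) (hW : W.toContRep.IsTopIrreducible)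
    {𝓐 : Set (H →L[ℂ] H)} (h𝓐 : ∀ (g : G), ∀ A ∈ 𝓐, (π g).comp A ∈ 𝓐) (hnd : ∀ v : H, (∀ A ∈ 𝓐, A v = 0) → v = 0)
    (hstar : ∀ A ∈ 𝓐, ContinuousLinearMap.adjoint A ∈ 𝓐) (hAW : ∀ A ∈ 𝓐, ∀ w ∈ W, A w ∈ W)
    (V : Submodule ℂ H) (hVc : IsClosed (V : Set H)) (P : H →L[ℂ] H) (hPV : ∀ x, P x ∈ V) (hPid : ∀ v ∈ V, P v = v) (hPsa : ∀ x y : H, ⟪P x, y⟫_ℂ = ⟪x, P y⟫_ℂ)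
    (hPW : ∀ w ∈ W, P w ∈ W)
    (T : J → H →L[ℂ] H) (hTV : ∀ j, ∀ x ∈ V, T j x ∈ V) (hTW : ∀ j, ∀ w ∈ W, T j w ∈ W) (hTB : ∀ j, ∀ A ∈ 𝓐, ∀ x ∈ V, P (A (T j x)) = T j (P (A x)))
    (U : H →ₗ[ℂ] Lp E 2 m) (s : J → Ω → ℂ) (hs : ∀ j, MemLp (s j) ∞ m) (hU : ∀ j, ∀ v ∈ V, U (T j v) = (hs j).toLp (s j) • U v)
    {Λ : Set Ω} (hΛ : MeasurableSet Λ) (hline : ∀ c : J → ℂ, m (Λ ∩ {x | ∀ j, s j x = c j}) = 0) (hΛ1 : MemLp (Λ.indicator fun _ : Ω => (1 : ℂ)) ∞ m)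
    {w : H} (hw : w ∈ W) :
    (hΛ1.toLp (Λ.indicator fun _ : Ω => (1 : ℂ)) • U (P w) : Lp E 2 m) = 0 := by
  -- restricted data on the Hilbert space `W`
  set Wm : Submodule ℂ H := W.toSubmodule with hWm
  set 𝓐W : Set (Wm →L[ℂ] Wm) := {B : Wm →L[ℂ] Wm | ∃ A, ∃ hA : A ∈ 𝓐, B = (A.comp Wm.subtypeL).codRestrict Wm fun w => hAW A hA (w : H) w.2} with h𝓐W
  set VW : Submodule ℂ Wm := V.comap Wm.subtype with hVW
  have hVWc : IsClosed (VW : Set Wm) := hVc.preimage continuous_subtype_val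
  set PW : Wm →L[ℂ] Wm := (P.comp Wm.subtypeL).codRestrict Wm (fun w => hPW (w : H) w.2) with hPWdef
  have hPVW : ∀ x : Wm, PW x ∈ VW := fun x => by
    rw [hVW, Submodule.mem_comap]
    exact hPV (x : H)
  have hPidW : ∀ x ∈ VW, PW x = x := fun x hx => Subtype.ext (hPid _ (Submodule.mem_comap.1 hx))
  have hPsaW : ∀ x y : Wm, ⟪PW x, y⟫_ℂ = ⟪x, PW y⟫_ℂ := fun x y => by
    rw [Submodule.coe_inner, Submodule.coe_inner]
    exact hPsa (x : H) (y : H)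
  set TW : J → Wm →L[ℂ] Wm := fun j => (((T j).comp Wm.subtypeL).codRestrict Wm fun w => hTW j (w : H) w.2) with hTWdef
  have hTVW : ∀ j, ∀ x ∈ VW, TW j x ∈ VW := fun j x hx => by
    rw [hVW, Submodule.mem_comap] at hx ⊢
    exact hTV j (x : H) hx
  have hTBW : ∀ j, ∀ B ∈ 𝓐W, ∀ x ∈ VW, PW (B (TW j x)) = TW j (PW (B x)) := by
    rintro j _ ⟨A, hA, rfl⟩ x hx
    apply Subtype.ext
    exact hTB j A hA (x : H) (Submodule.mem_comap.1 hx)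
  -- the scalars on `V ⊓ W` from (S3) on the irreducible `W`
  have hscalar : ∀ j, ∃ c : ℂ, ∀ v ∈ V ⊓ Wm, T j v = c • v := fun j => by
    obtain ⟨c, hc⟩ := exists_apply_eq_smul_of_commute_compression hW (restrict_A1 W h𝓐 hAW) (restrict_A2 W hnd hAW) (restrict_A3 W hstar hAW)
      VW hVWc PW hPVW hPidW hPsaW (TW j) (hTVW j) (hTBW j)
    refine ⟨c, fun v hv => ?_⟩
    have h := congrArg (fun x : Wm => (x : H)) (hc ⟨v, hv.2⟩ (Submodule.mem_comap.2 hv.1))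
    simp only [Submodule.coe_smul] at h
    exact h
  -- the analytic core on `V ⊓ W`
  exact indicator_lpSMul_eq_zero_of_eigen (V ⊓ Wm) U T s hs (fun j v hv => hU j v hv.1) hscalar hΛ hline hΛ1 ⟨hPV w, hPW w hw⟩

end Restrict

end Summit.HodgeConjecture.HodgeConjecture.Cruxes.H413.K2E1IrreducibleNoContinuousSpectrumU

end
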